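import Mathlib
import HarnessLib
import Summits.NavierStokesRegularity.FluidComputer.TriggeredTransferRelax

/-!
# Door N1-FC: no bounded window of Reynolds numbers bears on the existential crux; the dilation is
# an equivalence on single schemes up to trigger constants

Cell `ns-blowup`, seat `ns-blowup-fc-prover-2` (g4; D-0074 GROUP C «bridge support»; LADDER-NS rung
N1-FC «η > 1/λ UNIFORMLY IN Re»). LABEL: E–C typing / calibration. WHAT THIS IS NOT: not Navier–Stokes
evidence — implications between the OPEN predicates `TriggerScheme.Step` / `Transfers` / `TransfersB` of
the typed door and elementary real inequalities; no scheme instance, no transfer and no blow-up is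
asserted; the DNS words of PREREG-FC-TRIG-1 / -2 (pub-fluidc) are MODEL readings and never enter.
Sequel of `TriggeredTransferRelax.lean` (the relaxation preorder `Relaxes`, the constructors `raise`,
`inflate`).

## Content

* §3 **No bounded window of amplitudes bears on the existential crux.** A transferring scheme has
  inhabited amplitudes beyond every bound (`Transfers.exists_nonempty_ge`: step with the always
  admissible seed `ε = 1` — `ν |log 1| = 0 ≤ a U` at every viscosity — and climb by `growth > 1`), so it
  can be `raise`d past any `U₁` and still transfers (`Transfers.exists_relaxes_threshold_ge`); hence for
  EVERY `U₁` and every `ν`, `(∃ 𝒮, 𝒮.Transfers ν) ↔ (∃ 𝒮, U₁ ≤ 𝒮.UStar ∧ 𝒮.Transfers ν)`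
  (`exists_transfers_iff_threshold`; bounded twin `exists_transfersB_iff_threshold`): the existential
  crux says nothing about any bounded range of level Reynolds numbers. With the Re-dictionary of
  `TriggeredTransferViscosity` (`Step.of_div`: a viscosity sweep on a fixed host reads a bounded amplitude
  window of an infinite range) this is the kernel reason a decade of Reynolds numbers can speak to
  «∃ 𝒮, 𝒮.Transfers 1» only through its TREND as `Re → ∞` (the §6.3 census words of PREREG-FC-TRIG-2 —
  FALLING / FLAT / SATURATING / RISING — are trend words by design), while for ONE scheme whose alphabet
  contains the tested host a single missing step is a refutation (`not_transfers_of_not_step`, g3).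
* §4 **The dilation `u ↦ κ·u(κt,x)` is an equivalence on single schemes up to trigger constants.**
  Dilating by `κ` and back by `κ⁻¹` returns the scheme relaxed to `A i ↦ max(κ, κ⁻¹)^i · A i`
  (`relaxes_dilate_dilate_inv`), so `(𝒮.dilate κ).Step (κν) (κU) ε (κ • w) → (𝒮.inflate M).Step ν U ε w`
  and `(𝒮.dilate κ).Transfers (κν) → (𝒮.inflate M).Transfers ν` for `M ≥ max κ κ⁻¹` (`Step.of_dilate`,
  `Transfers.of_dilate`, `Transfers.of_dilate_div`) — the converses of `Step.dilate` / `Transfers.dilate`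
  (g3): the Re-dictionary loses nothing but the trigger shape constants.

References: T. Tao, J. Amer. Math. Soc. 29 (2016) 601–674, §1.3 [cite: Tao2016AveragedNS, §1.3];
T. Tao, Anal. PDE 6 (2013) 25–107, footnote 3 [cite: Tao2011, footnote 3]. 0 sorry; axioms ⊆
{propext, Classical.choice, Quot.sound}.
-/

noncomputable section

namespace Summit.NavierStokesRegularity.FluidComputer.TriggeredTransfer

open Set MeasureTheory Function
open scoped ENNReal ContDiff NNReal
open Literature.Analysis.FluidPDE
open Literature.Analysis.FluidPDE.FluidComputer (E3 Vel)

namespace TriggerScheme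

variable {𝒮 : TriggerScheme}

/-! ## §3 No bounded window of amplitudes bears on the existential crux -/

/-- **One step up with the always-admissible seed.** If `𝒮` transfers at viscosity `ν` (any real `ν`),
then from every inhabited amplitude `U ≥ U⋆` there is an inhabited amplitude `U' ≥ growth · U`: the
seed `ε = 1` is admissible at every amplitude (`ν |log 1| = 0 ≤ a U`). [folklore] -/
theorem Transfers.exists_nonempty_growth_mul_le {ν U : ℝ} (hT : 𝒮.Transfers ν) (hU : 𝒮.UStar ≤ U)
    (hne : (𝒮.F U).Nonempty) : ∃ U', 𝒮.UStar ≤ U' ∧ 𝒮.growth * U ≤ U' ∧ (𝒮.F U').Nonempty := by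
  obtain ⟨w, hw⟩ := hne
  have hU0 : 0 ≤ U := 𝒮.UStar_pos.le.trans hU
  have hadm : ν * |Real.log 1| ≤ 𝒮.a * U := by
    rw [Real.log_one, abs_zero, mul_zero]
    exact mul_nonneg 𝒮.a_pos.le hU0
  obtain ⟨T, δ, g, u, p, -, -, -, -, -, -, -, U', w', x₀, hgrow, hw', -, -⟩ :=
    hT U hU w hw 1 one_pos le_rfl hadm
  refine ⟨U', ?_, hgrow, w', hw'⟩
  exact hU.trans ((le_mul_of_one_le_left hU0 𝒮.one_le_growth).trans hgrow)

/-- **Inhabited amplitudes climb geometrically.** If `𝒮` transfers, then for every `n` some amplitude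
`U ≥ U₀ · growth^n` above threshold is inhabited, `U₀` the ignition amplitude. [folklore] -/
theorem Transfers.exists_nonempty_ge_pow {ν : ℝ} (hT : 𝒮.Transfers ν) :
    ∃ U₀, 𝒮.UStar ≤ U₀ ∧ ∀ n : ℕ, ∃ U, 𝒮.UStar ≤ U ∧ U₀ * 𝒮.growth ^ n ≤ U ∧ (𝒮.F U).Nonempty := by
  obtain ⟨U₀, hU₀, hne₀⟩ := 𝒮.seed
  refine ⟨U₀, hU₀, fun n => ?_⟩
  induction n with
  | zero => exact ⟨U₀, hU₀, by rw [pow_zero, mul_one], hne₀⟩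
  | succ n ih =>
    obtain ⟨U, hU, hUn, hne⟩ := ih
    obtain ⟨U', hU', hgrow, hne'⟩ := hT.exists_nonempty_growth_mul_le hU hne
    refine ⟨U', hU', ?_, hne'⟩
    calc U₀ * 𝒮.growth ^ (n + 1) = U₀ * 𝒮.growth ^ n * 𝒮.growth := by ring
      _ ≤ U * 𝒮.growth := mul_le_mul_of_nonneg_right hUn 𝒮.growth_pos.le
      _ = 𝒮.growth * U := mul_comm _ _
      _ ≤ U' := hgrow

/-- **A transferring scheme has inhabited amplitudes beyond every bound** (`growth > 1`). [folklore] -/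
theorem Transfers.exists_nonempty_ge {ν : ℝ} (hT : 𝒮.Transfers ν) (V : ℝ) :
    ∃ U, 𝒮.UStar ≤ U ∧ V ≤ U ∧ (𝒮.F U).Nonempty := by
  obtain ⟨U₀, hU₀, hclimb⟩ := hT.exists_nonempty_ge_pow
  have hU₀pos : 0 < U₀ := 𝒮.UStar_pos.trans_le hU₀
  obtain ⟨n, hn⟩ := pow_unbounded_of_one_lt (V / U₀) 𝒮.one_lt_growth
  obtain ⟨U, hU, hUn, hne⟩ := hclimb n
  refine ⟨U, hU, ?_, hne⟩
  have hV : V < U₀ * 𝒮.growth ^ n := by rwa [div_lt_iff₀' hU₀pos] at hn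
  exact hV.le.trans hUn

/-- **Raising the threshold of a transferring scheme past any bound.** If `𝒮` transfers at viscosity
`ν`, then for every `U₁` some relaxation of `𝒮` with threshold `≥ U₁` transfers at `ν` (raise the
threshold; the alphabet is inhabited above it by `Transfers.exists_nonempty_ge`). [folklore] -/
theorem Transfers.exists_relaxes_threshold_ge {ν : ℝ} (hT : 𝒮.Transfers ν) (U₁ : ℝ) :
    ∃ 𝒯 : TriggerScheme, 𝒮.Relaxes 𝒯 ∧ U₁ ≤ 𝒯.UStar ∧ 𝒯.Transfers ν :=
  ⟨𝒮.raise U₁ (hT.exists_nonempty_ge U₁), 𝒮.relaxes_raise _, 𝒮.le_raise_UStar _,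
    (𝒮.relaxes_raise _).transfers hT⟩

/-- The same for the bounded transfer predicate. [folklore] -/
theorem TransfersB.exists_relaxes_threshold_ge {ν : ℝ} (hT : 𝒮.TransfersB ν) (U₁ : ℝ) :
    ∃ 𝒯 : TriggerScheme, 𝒮.Relaxes 𝒯 ∧ U₁ ≤ 𝒯.UStar ∧ 𝒯.TransfersB ν :=
  ⟨𝒮.raise U₁ (hT.transfers.exists_nonempty_ge U₁), 𝒮.relaxes_raise _, 𝒮.le_raise_UStar _,
    (𝒮.relaxes_raise _).transfersB hT⟩

/-- **No bounded window of amplitudes bears on the existential crux.** For every viscosity `ν` and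
EVERY bound `U₁`: a transferring scheme exists iff one exists whose threshold is at least `U₁` — whose
transfer predicate says nothing about any amplitude (level Reynolds number) below `U₁`. With the
Re-dictionary `Step.of_div` (a viscosity sweep on a fixed host reads a bounded amplitude window of an
infinite range) a decade of Reynolds numbers speaks to «∃ 𝒮, 𝒮.Transfers 1» only through its trend as
`Re → ∞`; for ONE scheme containing the tested host a missing step is a refutation
(`not_transfers_of_not_step`). [folklore] -/
theorem exists_transfers_iff_threshold (ν U₁ : ℝ) :
    (∃ 𝒮 : TriggerScheme, 𝒮.Transfers ν) ↔
      ∃ 𝒮 : TriggerScheme, U₁ ≤ 𝒮.UStar ∧ 𝒮.Transfers ν := by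
  constructor
  · rintro ⟨𝒮, hT⟩
    obtain ⟨𝒯, -, hU₁, hT'⟩ := hT.exists_relaxes_threshold_ge U₁
    exact ⟨𝒯, hU₁, hT'⟩
  · rintro ⟨𝒮, -, hT⟩
    exact ⟨𝒮, hT⟩

/-- The bounded twin: `(∃ 𝒮, 𝒮.TransfersB ν) ↔ ∃ 𝒮, U₁ ≤ 𝒮.UStar ∧ 𝒮.TransfersB ν`. [folklore] -/
theorem exists_transfersB_iff_threshold (ν U₁ : ℝ) :
    (∃ 𝒮 : TriggerScheme, 𝒮.TransfersB ν) ↔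
      ∃ 𝒮 : TriggerScheme, U₁ ≤ 𝒮.UStar ∧ 𝒮.TransfersB ν := by
  constructor
  · rintro ⟨𝒮, hT⟩
    obtain ⟨𝒯, -, hU₁, hT'⟩ := hT.exists_relaxes_threshold_ge U₁
    exact ⟨𝒯, hU₁, hT'⟩
  · rintro ⟨𝒮, -, hT⟩
    exact ⟨𝒮, hT⟩

/-! ## §4 The dilation is an equivalence on single schemes, up to trigger constants -/

/-- The product of the two one-sided dilation factors is the two-sided one:
`max(κ⁻¹, 1) · max(κ, 1) = max(κ, κ⁻¹)` for `κ > 0`. [folklore] -/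
theorem max_inv_one_mul_max_one {κ : ℝ} (hκ : 0 < κ) : max κ⁻¹ 1 * max κ 1 = max κ κ⁻¹ := by
  rcases le_total κ 1 with hκ1 | hκ1
  · have hinv : 1 ≤ κ⁻¹ := one_le_inv_iff₀.2 ⟨hκ, hκ1⟩
    rw [max_eq_left hinv, max_eq_right hκ1, mul_one, max_eq_right (hκ1.trans hinv)]
  · have hinv : κ⁻¹ ≤ 1 := inv_le_one_of_one_le₀ hκ1
    rw [max_eq_right hinv, max_eq_left hκ1, one_mul, max_eq_left (hinv.trans hκ1)]

/-- The two-sided dilation factor is at least one. [folklore] -/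
theorem one_le_max_self_inv {κ : ℝ} (hκ : 0 < κ) : 1 ≤ max κ κ⁻¹ := by
  rcases le_total 1 κ with h1 | h1
  · exact le_max_of_le_left h1
  · exact le_max_of_le_right (one_le_inv_iff₀.2 ⟨hκ, h1⟩)

/-- **Dilating by `κ` and back by `κ⁻¹` relaxes to the geometric inflation `A i ↦ M^i · A i`** for any
`M ≥ max(κ, κ⁻¹)`: the alphabet returns (`κ⁻¹ • (κ • w) = w`), the threshold returns, and the trigger
constants become `(max(κ⁻¹,1) · max(κ,1))^i · A i = max(κ,κ⁻¹)^i · A i`. [cite: Tao2011, footnote 3] -/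
theorem relaxes_dilate_dilate_inv (𝒮 : TriggerScheme) {κ : ℝ} (hκ : 0 < κ) {M : ℝ}
    (hM : max κ κ⁻¹ ≤ M) :
    ((𝒮.dilate κ hκ).dilate κ⁻¹ (inv_pos.2 hκ)).Relaxes
      (𝒮.inflate M ((one_le_max_self_inv hκ).trans hM)) where
  lam_eq := rfl
  F_eq := by
    funext V
    show 𝒮.F V = (fun w : Vel => κ⁻¹ • w) '' ((fun w : Vel => κ • w) '' 𝒮.F (V / κ⁻¹ / κ))
    have hV : V / κ⁻¹ / κ = V := by rw [div_inv_eq_mul, mul_div_cancel_right₀ V hκ.ne']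
    have hid : (fun w : Vel => κ⁻¹ • (κ • w)) = id := by
      funext w
      rw [smul_smul, inv_mul_cancel₀ hκ.ne', one_smul, id]
    rw [hV, Set.image_image, hid, Set.image_id]
  eta_le := le_of_eq rfl
  UStar_le := by
    show κ⁻¹ * (κ * 𝒮.UStar) ≤ 𝒮.UStar
    rw [inv_mul_cancel_left₀ hκ.ne']
  R_le := le_of_eq rfl
  c_le := le_of_eq rfl
  D_le := le_of_eq rfl
  A_le i := by
    show (κ⁻¹) ^ 2 * (max κ⁻¹ 1) ^ i * (κ ^ 2 * (max κ 1) ^ i * 𝒮.A i) ≤ M ^ i * 𝒮.A i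
    have hre : (κ⁻¹) ^ 2 * (max κ⁻¹ 1) ^ i * (κ ^ 2 * (max κ 1) ^ i * 𝒮.A i) =
        (max κ κ⁻¹) ^ i * 𝒮.A i := by
      calc (κ⁻¹) ^ 2 * (max κ⁻¹ 1) ^ i * (κ ^ 2 * (max κ 1) ^ i * 𝒮.A i)
          = (κ⁻¹ * κ) ^ 2 * ((max κ⁻¹ 1 * max κ 1) ^ i * 𝒮.A i) := by ring
        _ = (max κ κ⁻¹) ^ i * 𝒮.A i := by
          rw [inv_mul_cancel₀ hκ.ne', one_pow, one_mul, max_inv_one_mul_max_one hκ]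
    rw [hre]
    exact mul_le_mul_of_nonneg_right
      (pow_le_pow_left₀ (zero_le_one.trans (one_le_max_self_inv hκ)) hM i) (𝒮.A_nonneg i)
  a_le := le_of_eq rfl
  Cτ_le := le_of_eq rfl
  q_le := le_of_eq rfl

/-- **The converse of `Step.dilate`, up to trigger constants**: a step of the dilated scheme at
viscosity `κν` from `κ • w` at amplitude `κU` (`U > 0`, `ε ≥ 0`) gives a step at viscosity `ν` from
`w` at amplitude `U` of the scheme with trigger constants `A i ↦ M^i · A i`, `M ≥ max(κ, κ⁻¹)` (dilate
back by `κ⁻¹`, then relax). [cite: Tao2011, footnote 3] -/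
theorem Step.of_dilate {κ : ℝ} (hκ : 0 < κ) {M : ℝ} (hM : max κ κ⁻¹ ≤ M) {ν U ε : ℝ} {w : Vel}
    (hU : 0 < U) (hε : 0 ≤ ε) (h : (𝒮.dilate κ hκ).Step (κ * ν) (κ * U) ε (κ • w)) :
    (𝒮.inflate M ((one_le_max_self_inv hκ).trans hM)).Step ν U ε w := by
  have h' := h.dilate (inv_pos.2 hκ)
  rw [inv_mul_cancel_left₀ hκ.ne', inv_mul_cancel_left₀ hκ.ne', smul_smul, inv_mul_cancel₀ hκ.ne',
    one_smul] at h'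
  exact (𝒮.relaxes_dilate_dilate_inv hκ hM).step hU hε h'

/-- **The converse of `Transfers.dilate`, up to trigger constants**: if the dilated scheme transfers
at viscosity `κν` then the scheme with trigger constants `A i ↦ M^i · A i` (`M ≥ max(κ, κ⁻¹)`) transfers
at viscosity `ν`. Together with `Transfers.dilate`: the dilation is an equivalence on single schemes up
to the trigger shape constants — the Re-dictionary `Step.of_div` loses nothing else.
[cite: Tao2011, footnote 3] -/
theorem Transfers.of_dilate {κ : ℝ} (hκ : 0 < κ) {M : ℝ} (hM : max κ κ⁻¹ ≤ M) {ν : ℝ}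
    (h : (𝒮.dilate κ hκ).Transfers (κ * ν)) :
    (𝒮.inflate M ((one_le_max_self_inv hκ).trans hM)).Transfers ν := by
  have h' := h.dilate (inv_pos.2 hκ)
  rw [inv_mul_cancel_left₀ hκ.ne'] at h'
  exact (𝒮.relaxes_dilate_dilate_inv hκ hM).transfers h'

/-- The same with the viscosity read the other way: if `𝒮.dilate κ` transfers at viscosity `ν` then
`𝒮.inflate M` transfers at viscosity `ν / κ`. [cite: Tao2011, footnote 3] -/
theorem Transfers.of_dilate_div {κ : ℝ} (hκ : 0 < κ) {M : ℝ} (hM : max κ κ⁻¹ ≤ M) {ν : ℝ}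
    (h : (𝒮.dilate κ hκ).Transfers ν) :
    (𝒮.inflate M ((one_le_max_self_inv hκ).trans hM)).Transfers (ν / κ) := by
  refine Transfers.of_dilate hκ hM ?_
  rwa [mul_div_cancel₀ _ hκ.ne']

end TriggerScheme

end Summit.NavierStokesRegularity.FluidComputer.TriggeredTransfer

end
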